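import Mathlib
import Summits.AnomalousDissipation.AnomalousDissipation.Theses.PointSink
import Summits.AnomalousDissipation.AnomalousDissipation.Theorems.SolitonTransplant.Negative.AntecedentRedundancy

/-!
# `PointSink.SolitonTransplant` (stmt-AnomalousDissipation-19035): the `L²`-mass envelope of the
antecedent is NOT load-bearing — minimal form of the antecedent

cdisprove record, companion of `Negative/AntecedentRedundancy.lean` (conjuncts (1)–(5) of the
antecedent = `CascadeSoliton` body as numbered there).

* `envelope_of_farField` — continuity of `Q` ∧ (5) ⇒ (2): the far-field sequence
  `a_k = λ^{-5k/3}∫_{shell k}‖Q−V‖² → 0` is bounded by some `M`; self-similarity gives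
  `∫_{shell k}‖V‖² = (λ^k)^{5/3}∫_{shell 0}‖V‖²` (`setIntegral_shell_eq`, `scal_eq`); hence
  `∫_{shell k}‖Q‖² ≤ (2M+2I₀)(λ^k)^{5/3}`, and covering `B_R` (`λ^m ≤ R < λ^{m+1}`) by `B̄_1`, the
  shells `k ≤ m` and finitely many null spheres, a geometric sum gives
  `∫_{B_R}‖Q‖² ≤ (∫_{B̄_1}‖Q‖² + (2M+2I₀)λ^{5/3}/(λ^{5/3}−1)) R^{5/3}`.
* `solitonTransplant_iff_minimal` — the crux is EQUIVALENT to the implication from the three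
  load-bearing conjuncts (1) smooth steady unforced Navier–Stokes ∧ (3) finite Dirichlet integral ∧
  (5) non-trivial DSS(−2/3) far field: "a D-solution with zero force whose blow-down converges in the
  normalised `L²`-shell sense to a non-trivial discretely self-similar profile of degree `-2/3`
  implies the point-sink zeroth law". A planner may shorten `CascadeSoliton` accordingly; a prover
  of `ConeDesingularisation` gets (2) and (4) for free. Classification: negative/tightness lemma
  about the hypotheses of the crux (no verdict change). [folklore]
-/

set_option linter.dupNamespace false  -- `Summit.AnomalousDissipation.AnomalousDissipation` is the mandated summit/problem namespace

noncomputable section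

open MeasureTheory Metric Filter Topology Set
open scoped Pointwise ENNReal
open Literature.Analysis.FluidPDE

namespace Summit.AnomalousDissipation.AnomalousDissipation.Theorems.SolitonTransplant.Negative

/-- Exponent bookkeeping: `(λ^k)^3 ((λ^{-2/3})^k)^2 = (λ^k)^{5/3}`. [folklore] -/
theorem scal_eq {lam : ℝ} (hlam : 0 < lam) (k : ℕ) :
    (lam ^ k) ^ 3 * ((lam ^ (-(2 / 3 : ℝ))) ^ k) ^ 2 = (lam ^ k) ^ (5 / 3 : ℝ) := by
  have e1 : (lam ^ k : ℝ) = lam ^ (k : ℝ) := (Real.rpow_natCast lam k).symm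
  have e2 : ((lam ^ (-(2 / 3 : ℝ))) ^ k) = lam ^ (-(2 / 3 : ℝ) * k) := by
    rw [Real.rpow_mul hlam.le, Real.rpow_natCast]
  rw [e1, e2, ← Real.rpow_natCast (lam ^ (k : ℝ)) 3, ← Real.rpow_mul hlam.le,
    ← Real.rpow_natCast (lam ^ (-(2 / 3 : ℝ) * k)) 2, ← Real.rpow_mul hlam.le,
    ← Real.rpow_mul hlam.le, ← Real.rpow_add hlam]
  norm_num
  ring_nf

/-- `(λ^k)^{5/3} = (λ^{5/3})^k`. [folklore] -/
theorem rpow_pow_comm {lam : ℝ} (hlam : 0 < lam) (k : ℕ) :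
    (lam ^ k) ^ (5 / 3 : ℝ) = (lam ^ (5 / 3 : ℝ)) ^ k := by
  rw [← Real.rpow_natCast_mul hlam.le, mul_comm, Real.rpow_mul_natCast hlam.le]

/-- **(2) is not load-bearing.** Continuity of `Q` and the far-field clause (5) already give the
`L²`-mass envelope `∫_{B_R}‖Q‖² ≤ C R^{5/3}` (`R ≥ 1`): the far-field sequence
`a_k = λ^{-5k/3}∫_{shell k}‖Q−V‖²` is bounded by some `M`, self-similarity gives
`∫_{shell k}‖V‖² = (λ^k)^{5/3} ∫_{shell 0}‖V‖²`, hence `∫_{shell k}‖Q‖² ≤ (2M + 2I₀)(λ^k)^{5/3}`;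
covering `B_R` (`λ^m ≤ R < λ^{m+1}`) by `B̄_1`, the shells `k ≤ m` and null spheres and summing the
geometric series gives the envelope with `C = ∫_{B̄_1}‖Q‖² + (2M+2I₀) λ^{5/3}/(λ^{5/3}−1)`. [folklore] -/
theorem envelope_of_farField {Q : (EuclideanSpace ℝ (Fin 3)) → (EuclideanSpace ℝ (Fin 3))} (hQ : Continuous Q)
    {lam : ℝ} (hlam : 1 < lam) {V : (EuclideanSpace ℝ (Fin 3)) → (EuclideanSpace ℝ (Fin 3))} (hVm : AEStronglyMeasurable V volume)
    (hV : ∀ x : (EuclideanSpace ℝ (Fin 3)), x ≠ 0 → V (lam • x) = lam ^ (-(2 / 3 : ℝ)) • V x)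
    (hVloc : LocallyIntegrableOn (fun x => ‖V x‖ ^ 2) {x : (EuclideanSpace ℝ (Fin 3)) | x ≠ 0} volume)
    (hV0 : 0 < ∫ x in {x : (EuclideanSpace ℝ (Fin 3)) | 1 < ‖x‖ ∧ ‖x‖ < lam}, ‖V x‖ ^ 2)
    (hfar : Tendsto (fun k : ℕ => (lam ^ k) ^ (-(5 / 3 : ℝ)) *
      ∫ x in {x : (EuclideanSpace ℝ (Fin 3)) | lam ^ k < ‖x‖ ∧ ‖x‖ < lam ^ (k + 1)}, ‖Q x - V x‖ ^ 2) atTop (𝓝 0)) :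
    ∃ C : ℝ, ∀ R : ℝ, 1 ≤ R → ∫ x in ball (0 : (EuclideanSpace ℝ (Fin 3))) R, ‖Q x‖ ^ 2 ≤ C * R ^ (5 / 3 : ℝ) := by
  have hlam0 : 0 < lam := lt_trans one_pos hlam
  set I₀ : ℝ := ∫ x in {x : (EuclideanSpace ℝ (Fin 3)) | 1 < ‖x‖ ∧ ‖x‖ < lam}, ‖V x‖ ^ 2 with hI₀_def
  -- the shells
  set S : ℕ → Set (EuclideanSpace ℝ (Fin 3)) := fun k => {x : (EuclideanSpace ℝ (Fin 3)) | lam ^ k < ‖x‖ ∧ ‖x‖ < lam ^ (k + 1)} with hS_def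
  set D : ℕ → ℝ := fun k => ∫ x in S k, ‖Q x - V x‖ ^ 2 with hD_def
  have hD0 : ∀ k, 0 ≤ D k := fun k => integral_nonneg fun x => sq_nonneg _
  -- boundedness of the far-field sequence
  obtain ⟨M, hM⟩ : ∃ M : ℝ, ∀ k, (lam ^ k) ^ (-(5 / 3 : ℝ)) * D k ≤ M := by
    obtain ⟨M, hM⟩ := hfar.bddAbove_range
    exact ⟨M, fun k => hM ⟨k, rfl⟩⟩
  have hpk : ∀ k : ℕ, 0 < (lam ^ k) ^ (5 / 3 : ℝ) := fun k => Real.rpow_pos_of_pos (pow_pos hlam0 k) _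
  have hDle : ∀ k, D k ≤ M * (lam ^ k) ^ (5 / 3 : ℝ) := by
    intro k
    have h := hM k
    rw [Real.rpow_neg (pow_pos hlam0 k).le, inv_mul_le_iff₀ (hpk k)] at h
    linarith
  have hM0 : 0 ≤ M := by
    have h := hM 0
    have : 0 ≤ (lam ^ 0) ^ (-(5 / 3 : ℝ)) * D 0 :=
      mul_nonneg (Real.rpow_nonneg (pow_pos hlam0 0).le _) (hD0 0)
    linarith
  -- integrability on shells
  have hclosedsub : ∀ k : ℕ, {x : (EuclideanSpace ℝ (Fin 3)) | lam ^ k ≤ ‖x‖ ∧ ‖x‖ ≤ lam ^ (k + 1)} ⊆ {x : (EuclideanSpace ℝ (Fin 3)) | x ≠ 0} := by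
    intro k x hx h0
    rw [mem_setOf_eq, h0, norm_zero] at hx
    linarith [hx.1, pow_pos hlam0 k]
  have hcompact : ∀ k : ℕ, IsCompact {x : (EuclideanSpace ℝ (Fin 3)) | lam ^ k ≤ ‖x‖ ∧ ‖x‖ ≤ lam ^ (k + 1)} := by
    intro k
    refine (isCompact_closedBall (0 : (EuclideanSpace ℝ (Fin 3))) (lam ^ (k + 1))).of_isClosed_subset ?_ ?_
    · exact (isClosed_le continuous_const continuous_norm).inter
        (isClosed_le continuous_norm continuous_const)
    · intro x hx
      rw [mem_closedBall, dist_zero_right]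
      exact hx.2
  have hSsub : ∀ k, S k ⊆ {x : (EuclideanSpace ℝ (Fin 3)) | lam ^ k ≤ ‖x‖ ∧ ‖x‖ ≤ lam ^ (k + 1)} :=
    fun k x hx => ⟨hx.1.le, hx.2.le⟩
  have hVint : ∀ k, IntegrableOn (fun x => ‖V x‖ ^ 2) (S k) volume := fun k =>
    (hVloc.integrableOn_compact_subset (hclosedsub k) (hcompact k)).mono_set (hSsub k)
  have hQint : ∀ r : ℝ, ∀ s : Set (EuclideanSpace ℝ (Fin 3)), s ⊆ closedBall (0 : (EuclideanSpace ℝ (Fin 3))) r →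
      IntegrableOn (fun x => ‖Q x‖ ^ 2) s volume := fun r s hs =>
    ((hQ.norm.pow 2).continuousOn.integrableOn_compact (isCompact_closedBall (0 : (EuclideanSpace ℝ (Fin 3))) r)).mono_set hs
  have hSball : ∀ k, S k ⊆ closedBall (0 : (EuclideanSpace ℝ (Fin 3))) (lam ^ (k + 1)) := fun k x hx => by
    rw [mem_closedBall, dist_zero_right]; exact hx.2.le
  have hsq : ∀ a b : (EuclideanSpace ℝ (Fin 3)), ‖a - b‖ ^ 2 ≤ 2 * ‖a‖ ^ 2 + 2 * ‖b‖ ^ 2 := by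
    intro a b
    have h1 : ‖a - b‖ ≤ ‖a‖ + ‖b‖ := norm_sub_le a b
    have h2 : ‖a - b‖ ^ 2 ≤ (‖a‖ + ‖b‖) ^ 2 := pow_le_pow_left₀ (norm_nonneg _) h1 2
    nlinarith [sq_nonneg (‖a‖ - ‖b‖)]
  have hQVint : ∀ k, IntegrableOn (fun x => ‖Q x - V x‖ ^ 2) (S k) volume := by
    intro k
    refine Integrable.mono' (((hQint _ _ (hSball k)).const_mul 2).add ((hVint k).const_mul 2))
      ((hQ.aestronglyMeasurable.sub hVm).norm.pow 2).restrict ?_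
    refine ae_of_all _ fun x => ?_
    rw [Real.norm_eq_abs, abs_of_nonneg (sq_nonneg _)]
    exact hsq (Q x) (V x)
  -- the shell bound `∫_{S k} ‖Q‖² ≤ (2M + 2I₀) (λ^k)^{5/3}`
  set B : ℝ := 2 * M + 2 * I₀ with hB_def
  have hB0 : 0 ≤ B := by have := hV0.le; positivity
  have hQshell : ∀ k, ∫ x in S k, ‖Q x‖ ^ 2 ≤ B * (lam ^ k) ^ (5 / 3 : ℝ) := by
    intro k
    have hpt : ∀ x, ‖Q x‖ ^ 2 ≤ 2 * ‖Q x - V x‖ ^ 2 + 2 * ‖V x‖ ^ 2 := by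
      intro x
      have := hsq (Q x - V x) (-(V x))
      simp only [sub_neg_eq_add, sub_add_cancel, norm_neg] at this
      exact this
    have h1 : ∫ x in S k, ‖Q x‖ ^ 2 ≤ ∫ x in S k, (2 * ‖Q x - V x‖ ^ 2 + 2 * ‖V x‖ ^ 2) :=
      integral_mono (hQint _ _ (hSball k)) (((hQVint k).const_mul 2).add ((hVint k).const_mul 2))
        hpt
    rw [integral_add ((hQVint k).const_mul 2) ((hVint k).const_mul 2), integral_const_mul,
      integral_const_mul] at h1
    have h2 : ∫ x in S k, ‖V x‖ ^ 2 = I₀ * (lam ^ k) ^ (5 / 3 : ℝ) := by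
      show ∫ x in {x : (EuclideanSpace ℝ (Fin 3)) | lam ^ k < ‖x‖ ∧ ‖x‖ < lam ^ (k + 1)}, ‖V x‖ ^ 2 = _
      rw [setIntegral_shell_eq hlam0 hV k, ← scal_eq hlam0 k, ← hI₀_def]
      ring
    have h3 : ∫ x in S k, ‖Q x - V x‖ ^ 2 = D k := rfl
    rw [h2, h3] at h1
    have h4 : 2 * D k ≤ 2 * (M * (lam ^ k) ^ (5 / 3 : ℝ)) := by linarith [hDle k]
    calc ∫ x in S k, ‖Q x‖ ^ 2 ≤ 2 * D k + 2 * (I₀ * (lam ^ k) ^ (5 / 3 : ℝ)) := h1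
      _ ≤ 2 * (M * (lam ^ k) ^ (5 / 3 : ℝ)) + 2 * (I₀ * (lam ^ k) ^ (5 / 3 : ℝ)) := by linarith
      _ = B * (lam ^ k) ^ (5 / 3 : ℝ) := by rw [hB_def]; ring
  -- lintegral version of the shell bound
  set g : (EuclideanSpace ℝ (Fin 3)) → ℝ≥0∞ := fun x => ENNReal.ofReal (‖Q x‖ ^ 2) with hg_def
  have hgshell : ∀ k, ∫⁻ x in S k, g x ≤ ENNReal.ofReal (B * (lam ^ k) ^ (5 / 3 : ℝ)) := by
    intro k
    rw [hg_def, ← ofReal_integral_eq_lintegral_ofReal (hQint _ _ (hSball k))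
      (ae_of_all _ fun x => sq_nonneg _)]
    exact ENNReal.ofReal_le_ofReal (hQshell k)
  -- the unit-ball constant
  set K₀ : ℝ≥0∞ := ∫⁻ x in closedBall (0 : (EuclideanSpace ℝ (Fin 3))) 1, g x with hK₀_def
  have hK₀ : K₀ < ∞ := by
    rw [hK₀_def, hg_def, ← ofReal_integral_eq_lintegral_ofReal (hQint 1 _ Subset.rfl)
      (ae_of_all _ fun x => sq_nonneg _)]
    exact ENNReal.ofReal_lt_top
  -- geometric constant
  set ρ : ℝ := lam ^ (5 / 3 : ℝ) with hρ_def
  have hρ1 : 1 < ρ := Real.one_lt_rpow hlam (by norm_num)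
  have hρ0 : 0 < ρ := lt_trans one_pos hρ1
  refine ⟨K₀.toReal + B * (ρ / (ρ - 1)), fun R hR => ?_⟩
  have hR0 : 0 < R := lt_of_lt_of_le one_pos hR
  obtain ⟨m, hm1, hm2⟩ := exists_nat_pow_near hR hlam
  -- cover of the ball
  have hcover : ball (0 : (EuclideanSpace ℝ (Fin 3))) R ⊆ closedBall (0 : (EuclideanSpace ℝ (Fin 3))) 1 ∪
      ((⋃ k : Fin (m + 1), S k) ∪ ⋃ k : Fin (m + 2), sphere (0 : (EuclideanSpace ℝ (Fin 3))) (lam ^ (k : ℕ))) := by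
    intro x hx
    rw [mem_ball, dist_zero_right] at hx
    by_cases h1 : ‖x‖ ≤ 1
    · left; rw [mem_closedBall, dist_zero_right]; exact h1
    · right
      push Not at h1
      obtain ⟨k, hk1, hk2⟩ := exists_nat_pow_near h1.le hlam
      have hkm : k < m + 1 := by
        have : lam ^ k < lam ^ (m + 1) := lt_of_le_of_lt hk1 (lt_trans hx hm2)
        exact (pow_lt_pow_iff_right₀ hlam).mp this
      rcases hk1.lt_or_eq with hlt | heq
      · left
        exact mem_iUnion.mpr ⟨⟨k, hkm⟩, ⟨hlt, hk2⟩⟩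
      · right
        refine mem_iUnion.mpr ⟨⟨k, by omega⟩, ?_⟩
        rw [mem_sphere, dist_zero_right]
        exact heq.symm
  have hspheres : volume (⋃ k : Fin (m + 2), sphere (0 : (EuclideanSpace ℝ (Fin 3))) (lam ^ (k : ℕ))) = 0 :=
    measure_iUnion_null fun k => Measure.addHaar_sphere_of_ne_zero volume (0 : (EuclideanSpace ℝ (Fin 3)))
      (pow_ne_zero _ hlam0.ne')
  have hlin : ∫⁻ x in ball (0 : (EuclideanSpace ℝ (Fin 3))) R, g x ≤
      K₀ + ENNReal.ofReal (B * ∑ k ∈ Finset.range (m + 1), ρ ^ k) := by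
    calc ∫⁻ x in ball (0 : (EuclideanSpace ℝ (Fin 3))) R, g x
        ≤ ∫⁻ x in closedBall (0 : (EuclideanSpace ℝ (Fin 3))) 1 ∪
            ((⋃ k : Fin (m + 1), S k) ∪ ⋃ k : Fin (m + 2), sphere (0 : (EuclideanSpace ℝ (Fin 3))) (lam ^ (k : ℕ))), g x :=
          lintegral_mono_set hcover
      _ ≤ K₀ + ((∫⁻ x in (⋃ k : Fin (m + 1), S k), g x) +
            (∫⁻ x in ⋃ k : Fin (m + 2), sphere (0 : (EuclideanSpace ℝ (Fin 3))) (lam ^ (k : ℕ)), g x)) := by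
          refine (lintegral_union_le _ _ _).trans ?_
          refine add_le_add le_rfl ?_
          exact lintegral_union_le _ _ _
      _ = K₀ + (∫⁻ x in (⋃ k : Fin (m + 1), S k), g x) := by
          rw [setLIntegral_measure_zero _ _ hspheres, add_zero]
      _ ≤ K₀ + ∑' k : Fin (m + 1), ∫⁻ x in S k, g x := by
          gcongr
          exact lintegral_iUnion_le _ _
      _ = K₀ + ∑ k : Fin (m + 1), ∫⁻ x in S k, g x := by
          rw [tsum_fintype]
      _ ≤ K₀ + ∑ k : Fin (m + 1), ENNReal.ofReal (B * (lam ^ (k : ℕ)) ^ (5 / 3 : ℝ)) := by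
          gcongr with k
          exact hgshell k
      _ = K₀ + ENNReal.ofReal (B * ∑ k ∈ Finset.range (m + 1), ρ ^ k) := by
          congr 1
          rw [← ENNReal.ofReal_sum_of_nonneg (fun k _ => by positivity), Finset.mul_sum,
            Fin.sum_univ_eq_sum_range (fun k => B * (lam ^ k) ^ (5 / 3 : ℝ)) (m + 1)]
          congr 1
          refine Finset.sum_congr rfl fun k _ => ?_
          rw [rpow_pow_comm hlam0 k]
  -- geometric sum bound
  have hgeom : ∑ k ∈ Finset.range (m + 1), ρ ^ k ≤ ρ / (ρ - 1) * R ^ (5 / 3 : ℝ) := by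
    rw [geom_sum_eq hρ1.ne' (m + 1)]
    have hρm : ρ ^ m ≤ R ^ (5 / 3 : ℝ) := by
      rw [hρ_def, ← rpow_pow_comm hlam0 m]
      exact Real.rpow_le_rpow (pow_pos hlam0 m).le hm1 (by norm_num)
    have hden : 0 < ρ - 1 := by linarith
    rw [div_le_iff₀ hden] at *
    calc ρ ^ (m + 1) - 1 ≤ ρ ^ (m + 1) := by linarith
      _ = ρ * ρ ^ m := by ring
      _ ≤ ρ * R ^ (5 / 3 : ℝ) := by gcongr
      _ = ρ / (ρ - 1) * R ^ (5 / 3 : ℝ) * (ρ - 1) := by field_simp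
  -- conclude in `ℝ`
  have hfin : K₀ + ENNReal.ofReal (B * ∑ k ∈ Finset.range (m + 1), ρ ^ k) ≠ ∞ :=
    ENNReal.add_ne_top.mpr ⟨hK₀.ne, ENNReal.ofReal_ne_top⟩
  have hreal : ∫ x in ball (0 : (EuclideanSpace ℝ (Fin 3))) R, ‖Q x‖ ^ 2 = (∫⁻ x in ball (0 : (EuclideanSpace ℝ (Fin 3))) R, g x).toReal :=
    integral_eq_lintegral_of_nonneg_ae (ae_of_all _ fun x => sq_nonneg _)
      (hQ.norm.pow 2).aestronglyMeasurable.restrict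
  rw [hreal]
  have h1 : (∫⁻ x in ball (0 : (EuclideanSpace ℝ (Fin 3))) R, g x).toReal ≤
      K₀.toReal + B * ∑ k ∈ Finset.range (m + 1), ρ ^ k := by
    have := ENNReal.toReal_mono hfin hlin
    rwa [ENNReal.toReal_add hK₀.ne ENNReal.ofReal_ne_top,
      ENNReal.toReal_ofReal (by positivity)] at this
  have hR53 : 1 ≤ R ^ (5 / 3 : ℝ) := Real.one_le_rpow hR (by norm_num)
  have hK0r : 0 ≤ K₀.toReal := ENNReal.toReal_nonneg
  calc (∫⁻ x in ball (0 : (EuclideanSpace ℝ (Fin 3))) R, g x).toReal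
      ≤ K₀.toReal + B * ∑ k ∈ Finset.range (m + 1), ρ ^ k := h1
    _ ≤ K₀.toReal * R ^ (5 / 3 : ℝ) + B * (ρ / (ρ - 1) * R ^ (5 / 3 : ℝ)) := by
        gcongr
        · exact le_mul_of_one_le_right hK0r hR53
    _ = (K₀.toReal + B * (ρ / (ρ - 1))) * R ^ (5 / 3 : ℝ) := by ring


open Summit.AnomalousDissipation.AnomalousDissipation.Theses.PointSink in
/-- **Minimal antecedent.** `SolitonTransplant` is equivalent to the implication from the
three genuinely load-bearing conjuncts — (1) smooth steady unforced Navier–Stokes, (3) finite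
Dirichlet integral, (5) non-trivial DSS far field — i.e. from "a D-solution with zero force whose
blow-down converges, in the normalised `L²`-shell sense, to a non-trivial discretely self-similar
profile of degree `-2/3`"; the envelope (2) and the positivity (4) are consequences
(`envelope_of_farField`, `dissipation_pos_of_farField`). [folklore] -/
theorem solitonTransplant_iff_minimal :
    SolitonTransplant ↔
      ((∃ (Q : EuclideanSpace ℝ (Fin 3) → EuclideanSpace ℝ (Fin 3)) (P : EuclideanSpace ℝ (Fin 3) → ℝ), Literature.Analysis.FluidPDE.IsClassicalNSSolutionOn Set.univ 1 (fun _ _ => 0) (fun _ => Q) (fun _ => P) ∧ MeasureTheory.Integrable (fun x => Literature.Analysis.FluidPDE.frobeniusNormSq (fderiv ℝ Q x)) ∧ ∃ (lam : ℝ) (V : EuclideanSpace ℝ (Fin 3) → EuclideanSpace ℝ (Fin 3)), 1 < lam ∧ MeasureTheory.AEStronglyMeasurable V MeasureTheory.volume ∧ (∀ x : EuclideanSpace ℝ (Fin 3), x ≠ 0 → V (lam • x) = lam ^ (-(2 / 3 : ℝ)) • V x) ∧ MeasureTheory.LocallyIntegrableOn (fun x => ‖V x‖ ^ 2) {x : EuclideanSpace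 ℝ (Fin 3) | x ≠ 0} MeasureTheory.volume ∧ 0 < ∫ x in {x : EuclideanSpace ℝ (Fin 3) | 1 < ‖x‖ ∧ ‖x‖ < lam}, ‖V x‖ ^ 2 ∧ Filter.Tendsto (fun k : ℕ => (lam ^ k) ^ (-(5 / 3 : ℝ)) * ∫ x in {x : EuclideanSpace ℝ (Fin 3) | lam ^ k < ‖x‖ ∧ ‖x‖ < lam ^ (k + 1)}, ‖Q x - V x‖ ^ 2) Filter.atTop (nhds 0)) → PointSinkZerothLaw) := by
  constructor
  · rintro h ⟨Q, P, h1, h3, lam, V, hlam, hVm, hV, hVloc, hV0, hfar⟩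
    have hQ : ContDiff ℝ 1 Q :=
      (h1.contDiff_velocity (Set.mem_univ (0 : ℝ))).of_le (by exact_mod_cast le_top)
    have h2 := envelope_of_farField hQ.continuous hlam hVm hV hVloc hV0 hfar
    exact h ⟨Q, P, h1, h2, h3, dissipation_pos_of_farField hQ h2 h3 hlam hV hV0 hfar, lam, V, hlam,
      hVm, hV, hVloc, hV0, hfar⟩
  · rintro h ⟨Q, P, h1, -, h3, -, h5⟩
    exact h ⟨Q, P, h1, h3, h5⟩

end Summit.AnomalousDissipation.AnomalousDissipation.Theorems.SolitonTransplant.Negative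

end
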